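import Mathlib
import Literature.Geometry.DiscreteGeometry.KissingNodeDegree
import Summits.AtomisticToContinuum.Crystallization.Theorems.LaminarSixThreeThreeLaminarKissingCap
import HarnessLib

/-!
# Crux `SquareWellLayerCake.AveragedTwelve` (stmt-AtomisticToContinuum-15806), line `Sketch`
# (idea par-five-delaunay-recount), stub `stub_lensSix` — lens capacity six

This file is stub `stub_lensSix` of line `Sketch` (idea par-five-delaunay-recount) of crux
`SquareWellLayerCake.AveragedTwelve` (stmt-AtomisticToContinuum-15806).

**Statement.** Let `0 < d`, `ρ ≤ (57/50) d`, and let `x, y ∈ ℝ³` be a *near pair*,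
`d ≤ ℓ := |xy| ≤ ρ`.  If `S` is a finite `d`-separated set of points `z` with `d ≤ |zx| ≤ ρ` and
`d ≤ |zy| ≤ ρ` (the *lens* of the pair), then `|S| ≤ 6`.

**Proof.** Take the unit vector `n = (y - x)/ℓ` and an orthonormal frame `b` of `ℝ³` with third
vector `n` (`exists_frame`); write `z - x = (X, Y, H)`.  For one lens point the four distance
constraints give, with `u = X² + Y²`, the bounds `u + 5 (H − ℓ/2)² ≤ ρ² − ℓ²/4` and
`u ≥ d² − ℓ²/4 > 0` (`lens_point_bounds`: the height above the mid-plane is `≤ 0.15 ℓ`).  For two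
lens points at distance `≥ d` the planar parts then satisfy `X X' + Y Y' ≤ (3/5) r r'`, `r² = u`
(`planar_inner_le`, a polynomial estimate with `10 %` margin), i.e. in polar form
`θ = arg (X + iY)` one has `cos (θ − θ') ≤ 3/5`.  Seven lens points would give seven distinct
directions; sorted, their six consecutive gaps and the wrap-around gap are each `≥ arccos (3/5)`
and sum to `2π` — but `7 arccos (3/5) > 2π` (`two_pi_lt_seven_arccos`: for `α = arccos (3/5)`,
`cos 3α = −117/125 < −527/625 = cos 4α = cos (2π − 4α)` with `0 ≤ 3α`, `2π − 4α ≤ π`).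
Patterns: `Literature/Geometry/DiscreteGeometry/KissingNodeDegree.lean` (Hales 2012, Lemma 7: frame,
polar form, sorted gaps); the sorted-gaps step `LaminarKissingCap.seven_sorted_angles_false` is
imported from `LaminarSixThreeThreeLaminarKissingCap.lean` (seven directions, general `κ`).
No interval arithmetic is needed (the bound holds numerically up to `ρ ≈ 1.256 d`).
-/

noncomputable section

namespace Summit.AtomisticToContinuum.Crystallization.Theorems.ParFiveRecountLensSix

open Real RealInnerProductSpace Literature.Geometry.DiscreteGeometry

/-! ### Trigonometry: seven gaps of cosine `≤ 3/5` do not fit around a circle -/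

/-- `2π < 7 · arccos (3/5)` (`arccos (3/5) ≈ 53.13° > 360°/7 ≈ 51.43°`).  With `α = arccos (3/5)`:
`cos 3α = −117/125 < −527/625 = cos 4α = cos (2π − 4α)`, while `0 ≤ 3α` and `2π − 4α ≤ π`
(as `α > π/4`, i.e. `3/5 < √2/2`); since `cos` is antitone on `[0, π]` this forces
`3α > 2π − 4α`. [folklore] -/
theorem two_pi_lt_seven_arccos : 2 * π < 7 * arccos (3 / 5) := by
  have hα4 : π / 4 < arccos (3 / 5) := by
    rw [← not_le, arccos_le_pi_div_four, not_le, lt_div_iff₀ (by norm_num : (0 : ℝ) < 2),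
      lt_sqrt (by norm_num)]
    norm_num
  have hc : cos (arccos (3 / 5)) = 3 / 5 := cos_arccos (by norm_num) (by norm_num)
  have hα0 : 0 ≤ arccos (3 / 5) := arccos_nonneg _
  generalize arccos (3 / 5) = α at hα4 hc hα0 ⊢
  have h3 : cos (3 * α) = -117 / 125 := by rw [cos_three_mul, hc]; norm_num
  have h2 : cos (2 * α) = -7 / 25 := by rw [cos_two_mul, hc]; norm_num
  have h4 : cos (4 * α) = -527 / 625 := by
    rw [show 4 * α = 2 * (2 * α) by ring, cos_two_mul, h2]; norm_num
  by_contra h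
  have h' := not_lt.1 h
  have hle : cos (2 * π - 4 * α) ≤ cos (3 * α) :=
    cos_le_cos_of_nonneg_of_le_pi (by linarith) (by linarith) (by linarith)
  rw [cos_two_pi_sub, h4, h3] at hle
  norm_num at hle

/-! ### Real estimates for one and two lens points -/

/-- **One lens point.** In coordinates with `x = 0`, `y = (0, 0, ℓ)`, a point `(X, Y, H)` with
`d ≤ |zx|, |zy| ≤ ρ` (`u = X² + Y²`), where `d ≤ ℓ ≤ ρ ≤ 1.14 d`, has height
`0.35 ℓ ≤ H ≤ 0.65 ℓ` (from `|2Hℓ − ℓ²| ≤ ρ² − d²`), hence `u + 5 (H − ℓ/2)² ≤ ρ² − ℓ²/4` and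
`u ≥ d² − ℓ²/4`. [folklore] -/
theorem lens_point_bounds {d ℓ ρ u H : ℝ} (hd : 0 < d) (hdl : d ≤ ℓ) (hlρ : ℓ ≤ ρ)
    (hρ : ρ ≤ 57 / 50 * d) (h1 : d ^ 2 ≤ u + H ^ 2) (h2 : u + H ^ 2 ≤ ρ ^ 2)
    (h3 : d ^ 2 ≤ u + (H - ℓ) ^ 2) (h4 : u + (H - ℓ) ^ 2 ≤ ρ ^ 2) :
    u + 5 * (H - ℓ / 2) ^ 2 ≤ ρ ^ 2 - ℓ ^ 2 / 4 ∧ d ^ 2 - ℓ ^ 2 / 4 ≤ u := by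
  have hℓ : 0 < ℓ := hd.trans_le hdl
  have hρ2 : ρ ^ 2 ≤ 3249 / 2500 * d ^ 2 := by
    nlinarith [mul_nonneg (sub_nonneg.2 hρ) (by linarith : 0 ≤ 57 / 50 * d + ρ)]
  have hd2 : d ^ 2 ≤ ℓ ^ 2 := pow_le_pow_left₀ hd.le hdl 2
  have hup : 2 * H * ℓ ≤ 3249 / 2500 * ℓ ^ 2 := by nlinarith
  have hlow : 1751 / 2500 * ℓ ^ 2 ≤ 2 * H * ℓ := by nlinarith
  have hHhi : H ≤ 3249 / 5000 * ℓ := le_of_mul_le_mul_right (by nlinarith) hℓ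
  have hHlo : 1751 / 5000 * ℓ ≤ H := le_of_mul_le_mul_right (by nlinarith) hℓ
  rcases le_total (ℓ / 2) H with hc | hc
  · constructor
    · nlinarith [mul_nonneg (sub_nonneg.2 hc) (show 0 ≤ 3 * ℓ - 4 * H by linarith)]
    · nlinarith [mul_nonneg (sub_nonneg.2 hc) (show 0 ≤ 3 * ℓ - 2 * H by linarith)]
  · constructor
    · nlinarith [mul_nonneg (sub_nonneg.2 hc) (show 0 ≤ 4 * H - ℓ by linarith)]
    · nlinarith [mul_nonneg (sub_nonneg.2 hc) (show 0 ≤ 2 * H + ℓ by linarith)]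

/-- **Two lens points: the planar angle.** If two lens points (in the bounds of
`lens_point_bounds`, planar radii `r, r'` with `r² = u`, `r'² = u'`, mid-plane heights `h, h'`)
are at distance `≥ d`, i.e. `d² ≤ u + u' − 2P + (h − h')²` for the planar inner product `P`, then
`P ≤ (3/5) r r'`.  Indeed `2P ≤ (3/5)(u + u') + (4/5)(ρ² − ℓ²/4) − d²` (using `(h − h')² ≤ 2h² + 2h'²`
and `2h² ≤ (2/5)(ρ² − ℓ²/4 − u)`), `(6/5) r r' = (3/5)(u + u') − (3/5)(r − r')²`, and
`(r − r')² ≤ d²/10` (as `(r − r')² (r + r')² = (u − u')² ≤ (ρ² − d²)²` and `(r + r')² ≥ 1.35 d²`),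
with `(4/5)(ρ² − ℓ²/4) ≤ 0.84 d²`. [folklore] -/
theorem planar_inner_le {d ℓ ρ u u' h h' P r r' : ℝ} (hd : 0 < d) (hdl : d ≤ ℓ) (hlρ : ℓ ≤ ρ)
    (hρ : ρ ≤ 57 / 50 * d) (hr : 0 ≤ r) (hru : r ^ 2 = u) (hr' : 0 ≤ r') (hru' : r' ^ 2 = u')
    (hp : u + 5 * h ^ 2 ≤ ρ ^ 2 - ℓ ^ 2 / 4) (hlo : d ^ 2 - ℓ ^ 2 / 4 ≤ u)
    (hp' : u' + 5 * h' ^ 2 ≤ ρ ^ 2 - ℓ ^ 2 / 4) (hlo' : d ^ 2 - ℓ ^ 2 / 4 ≤ u')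
    (hsep : d ^ 2 ≤ u + u' - 2 * P + (h - h') ^ 2) : P ≤ 3 / 5 * (r * r') := by
  have hρ2 : ρ ^ 2 ≤ 3249 / 2500 * d ^ 2 := by
    nlinarith [mul_nonneg (sub_nonneg.2 hρ) (by linarith : 0 ≤ 57 / 50 * d + ρ)]
  have hd2 : d ^ 2 ≤ ℓ ^ 2 := pow_le_pow_left₀ hd.le hdl 2
  have hℓ2 : ℓ ^ 2 ≤ ρ ^ 2 := pow_le_pow_left₀ (by linarith) hlρ 2
  have hd4 : 0 < d ^ 4 := pow_pos hd 4
  -- the two planar radii are close: `(r - r')² ≤ d²/10`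
  have hdiff : (r - r') ^ 2 ≤ d ^ 2 / 10 := by
    have hprod : (r - r') ^ 2 * (r + r') ^ 2 = (u - u') ^ 2 := by rw [← hru, ← hru']; ring
    have hsum : 27 / 20 * d ^ 2 ≤ (r + r') ^ 2 := by nlinarith [mul_nonneg hr hr']
    have huu : (u - u') ^ 2 ≤ (749 / 2500 * d ^ 2) ^ 2 := by
      have e1 : u - u' ≤ 749 / 2500 * d ^ 2 := by nlinarith [sq_nonneg h]
      have e2 : u' - u ≤ 749 / 2500 * d ^ 2 := by nlinarith [sq_nonneg h']
      nlinarith [mul_nonneg (sub_nonneg.2 e1) (by linarith : 0 ≤ 749 / 2500 * d ^ 2 + (u - u'))]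
    by_contra hc
    have hc' := not_le.1 hc
    have hpos : 0 < (r + r') ^ 2 := by nlinarith
    have key : d ^ 2 / 10 * (27 / 20 * d ^ 2) < (u - u') ^ 2 :=
      calc d ^ 2 / 10 * (27 / 20 * d ^ 2) ≤ d ^ 2 / 10 * (r + r') ^ 2 :=
            mul_le_mul_of_nonneg_left hsum (by positivity)
        _ < (r - r') ^ 2 * (r + r') ^ 2 := mul_lt_mul_of_pos_right hc' hpos
        _ = (u - u') ^ 2 := hprod
    nlinarith [key, huu, hd4]
  -- the main estimate
  have key : 2 * P ≤ 3 / 5 * (u + u') + 4 / 5 * (ρ ^ 2 - ℓ ^ 2 / 4) - d ^ 2 := by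
    nlinarith [hsep, hp, hp', sq_nonneg (h + h')]
  have key2 : 6 / 5 * (r * r') = 3 / 5 * (u + u') - 3 / 5 * (r - r') ^ 2 := by
    rw [← hru, ← hru']; ring
  nlinarith [key, key2, hdiff, hρ2, hd2, sq_nonneg d]

/-! ### Seven lens points in coordinates -/

/-- **No seven lens points (coordinate form).** With `x = 0`, `y = (0, 0, ℓ)`,
`d ≤ ℓ ≤ ρ ≤ 1.14 d`, seven points `(Xᵢ, Yᵢ, Hᵢ)` with `d ≤ |z x|, |z y| ≤ ρ` and pairwise distances
`≥ d` do not exist: in polar form `θᵢ = arg (Xᵢ + i Yᵢ)` (radii `> 0`) any two directions satisfy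
`cos (θᵢ − θₖ) ≤ 3/5` (`planar_inner_le`), so the `θᵢ` are distinct and, sorted, contradict
`LaminarKissingCap.seven_sorted_angles_false` (with `two_pi_lt_seven_arccos`). [folklore] -/
theorem no_seven_lens_coords {d ℓ ρ : ℝ} (hd : 0 < d) (hdl : d ≤ ℓ) (hlρ : ℓ ≤ ρ)
    (hρ : ρ ≤ 57 / 50 * d) (X Y H : Fin 7 → ℝ)
    (hx1 : ∀ i, d ^ 2 ≤ X i ^ 2 + Y i ^ 2 + H i ^ 2)
    (hx2 : ∀ i, X i ^ 2 + Y i ^ 2 + H i ^ 2 ≤ ρ ^ 2)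
    (hy1 : ∀ i, d ^ 2 ≤ X i ^ 2 + Y i ^ 2 + (H i - ℓ) ^ 2)
    (hy2 : ∀ i, X i ^ 2 + Y i ^ 2 + (H i - ℓ) ^ 2 ≤ ρ ^ 2)
    (hsep : ∀ i k, i ≠ k → d ^ 2 ≤ (X i - X k) ^ 2 + (Y i - Y k) ^ 2 + (H i - H k) ^ 2) :
    False := by
  -- adapted from `LaminarKissingCap.no_seven_annulus` / `no_five_neighbours`
  set r : Fin 7 → ℝ := fun i => ‖(⟨X i, Y i⟩ : ℂ)‖ with hrdef
  set θ : Fin 7 → ℝ := fun i => Complex.arg ⟨X i, Y i⟩ with hθdef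
  have hrsq : ∀ i, r i ^ 2 = X i ^ 2 + Y i ^ 2 := by
    intro i
    simp only [hrdef, Complex.sq_norm, Complex.normSq_mk]
    ring
  have hr0 : ∀ i, 0 ≤ r i := fun i => norm_nonneg _
  have hpt : ∀ i, X i ^ 2 + Y i ^ 2 + 5 * (H i - ℓ / 2) ^ 2 ≤ ρ ^ 2 - ℓ ^ 2 / 4 ∧
      d ^ 2 - ℓ ^ 2 / 4 ≤ X i ^ 2 + Y i ^ 2 :=
    fun i => lens_point_bounds hd hdl hlρ hρ (hx1 i) (hx2 i) (hy1 i) (hy2 i)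
  have hρ2 : ρ ^ 2 ≤ 3249 / 2500 * d ^ 2 := by
    nlinarith [mul_nonneg (sub_nonneg.2 hρ) (by linarith : 0 ≤ 57 / 50 * d + ρ)]
  have hℓ2 : ℓ ^ 2 ≤ ρ ^ 2 := pow_le_pow_left₀ (by linarith) hlρ 2
  have hrpos : ∀ i, 0 < r i := by
    intro i
    have h2 : 0 < r i ^ 2 := by rw [hrsq]; nlinarith [(hpt i).2]
    rcases (hr0 i).lt_or_eq with h | h
    · exact h
    · rw [← h] at h2; norm_num at h2
  have hX : ∀ i, X i = r i * cos (θ i) := fun i => (Complex.norm_mul_cos_arg ⟨X i, Y i⟩).symm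
  have hY : ∀ i, Y i = r i * sin (θ i) := fun i => (Complex.norm_mul_sin_arg ⟨X i, Y i⟩).symm
  have hcos : ∀ i k, i ≠ k → cos (θ i - θ k) ≤ 3 / 5 := by
    intro i k hik
    have hdot : X i * X k + Y i * Y k = r i * r k * cos (θ i - θ k) := by
      rw [hX i, hX k, hY i, hY k, cos_sub]; ring
    have hs : d ^ 2 ≤ (X i ^ 2 + Y i ^ 2) + (X k ^ 2 + Y k ^ 2) - 2 * (X i * X k + Y i * Y k)
        + ((H i - ℓ / 2) - (H k - ℓ / 2)) ^ 2 := by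
      linarith [hsep i k hik]
    have hle : X i * X k + Y i * Y k ≤ 3 / 5 * (r i * r k) :=
      planar_inner_le hd hdl hlρ hρ (hr0 i) (hrsq i) (hr0 k) (hrsq k) (hpt i).1 (hpt i).2
        (hpt k).1 (hpt k).2 hs
    rw [hdot] at hle
    have hpos : 0 < r i * r k := mul_pos (hrpos i) (hrpos k)
    by_contra hc
    have := mul_lt_mul_of_pos_left (not_le.1 hc) hpos
    linarith
  have hθinj : Function.Injective θ := by
    intro i k hik
    by_contra hne
    have := hcos i k hne
    rw [hik, sub_self, cos_zero] at this
    norm_num at this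
  have hAcard : (Finset.univ.image θ).card = 7 := by
    rw [Finset.card_image_of_injective _ hθinj, Finset.card_univ, Fintype.card_fin]
  let e := (Finset.univ.image θ).orderEmbOfFin hAcard
  have hmem : ∀ k, ∃ i, θ i = e k := by
    intro k
    have := (Finset.univ.image θ).orderEmbOfFin_mem hAcard k
    rw [Finset.mem_image] at this
    obtain ⟨i, -, hi⟩ := this
    exact ⟨i, hi⟩
  choose π' hπ' using hmem
  refine LaminarKissingCap.seven_sorted_angles_false two_pi_lt_seven_arccos (fun k => e k)
    e.strictMono ?_ ?_ ?_
  · show -π < e 0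
    rw [← hπ' 0]
    exact Complex.neg_pi_lt_arg _
  · show e 6 ≤ π
    rw [← hπ' 6]
    exact Complex.arg_le_pi _
  · intro i j hij
    have hne : π' i ≠ π' j := by
      intro h
      apply hij
      apply e.injective
      rw [← hπ' i, ← hπ' j, h]
    rw [← hπ' i, ← hπ' j]
    exact hcos _ _ hne

/-! ### A frame adapted to the pair, and the geometric statement -/

/-- Coordinates in an orthonormal frame of `ℝ³` whose third vector is the unit vector `n`:
`b 0 ⊥ n`, `b 1 ⊥ n`, `‖v‖² = ⟪b 0, v⟫² + ⟪b 1, v⟫² + ⟪v, n⟫²` and the same for differences.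
[folklore] -/
theorem exists_frame {n : EuclideanSpace ℝ (Fin 3)} (hn : ‖n‖ = 1) :
    ∃ b : OrthonormalBasis (Fin 3) ℝ (EuclideanSpace ℝ (Fin 3)),
      ⟪b 0, n⟫ = 0 ∧ ⟪b 1, n⟫ = 0 ∧
      (∀ v, ‖v‖ ^ 2 = ⟪b 0, v⟫ ^ 2 + ⟪b 1, v⟫ ^ 2 + ⟪v, n⟫ ^ 2) ∧
      ∀ v w, ‖v - w‖ ^ 2
        = (⟪b 0, v⟫ - ⟪b 0, w⟫) ^ 2 + (⟪b 1, v⟫ - ⟪b 1, w⟫) ^ 2 + (⟪v, n⟫ - ⟪w, n⟫) ^ 2 := by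
  -- adapted from `LaminarKissingCap.exists_frame`
  obtain ⟨b, hb⟩ := exists_orthonormalBasis_third_eq (v := (2 : ℝ) • n)
    (by rw [norm_smul, hn]; norm_num)
  rw [smul_smul, show (1 / 2 * 2 : ℝ) = 1 by norm_num, one_smul] at hb
  refine ⟨b, ?_, ?_, fun v => ?_, fun v w => ?_⟩
  · rw [← hb]; exact b.inner_eq_zero (by decide)
  · rw [← hb]; exact b.inner_eq_zero (by decide)
  · rw [← real_inner_self_eq_norm_sq, inner_eq_sum_three b, hb, real_inner_comm n]; ring
  · rw [← real_inner_self_eq_norm_sq, inner_eq_sum_three b, hb]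
    simp only [inner_sub_right, real_inner_comm n]
    ring

/-- **No seven lens points.** For a near pair `x, y` (`d ≤ |xy| ≤ ρ ≤ 1.14 d`, `0 < d`) there are
no seven points `u₀, …, u₆` with `d ≤ |uₖ x|, |uₖ y| ≤ ρ` and `|uᵢ uⱼ| ≥ d` for `i ≠ j`
(coordinates in a frame with third vector `(y − x)/|xy|`, then `no_seven_lens_coords`).
[folklore] -/
theorem no_seven_lens_points {d ρ : ℝ} (hd : 0 < d) (hρ : ρ ≤ 57 / 50 * d)
    {x y : EuclideanSpace ℝ (Fin 3)} (hxy : d ≤ dist x y) (hxy' : dist x y ≤ ρ)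
    (u : Fin 7 → EuclideanSpace ℝ (Fin 3))
    (hu : ∀ k, d ≤ dist (u k) x ∧ dist (u k) x ≤ ρ ∧ d ≤ dist (u k) y ∧ dist (u k) y ≤ ρ)
    (hsep : ∀ i j, i ≠ j → d ≤ dist (u i) (u j)) : False := by
  set ℓ := dist x y with hℓdef
  have hℓ : 0 < ℓ := hd.trans_le hxy
  have hyx : ‖y - x‖ = ℓ := by rw [← dist_eq_norm, dist_comm]
  obtain ⟨n, hn, hyxn⟩ : ∃ n : EuclideanSpace ℝ (Fin 3), ‖n‖ = 1 ∧ y - x = ℓ • n :=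
    ⟨ℓ⁻¹ • (y - x), by
      rw [norm_smul, norm_inv, Real.norm_eq_abs, abs_of_pos hℓ, hyx, inv_mul_cancel₀ hℓ.ne'],
      by rw [smul_smul, mul_inv_cancel₀ hℓ.ne', one_smul]⟩
  obtain ⟨b, hb0, hb1, hnorm, hdiff⟩ := exists_frame hn
  have hX0 : ⟪b 0, y - x⟫ = 0 := by rw [hyxn, real_inner_smul_right, hb0, mul_zero]
  have hY0 : ⟪b 1, y - x⟫ = 0 := by rw [hyxn, real_inner_smul_right, hb1, mul_zero]
  have hH0 : ⟪y - x, n⟫ = ℓ := by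
    rw [hyxn, real_inner_smul_left, real_inner_self_eq_norm_sq, hn]; ring
  have hdx : ∀ k, dist (u k) x ^ 2
      = ⟪b 0, u k - x⟫ ^ 2 + ⟪b 1, u k - x⟫ ^ 2 + ⟪u k - x, n⟫ ^ 2 := fun k => by
    rw [dist_eq_norm]; exact hnorm _
  have hdy : ∀ k, dist (u k) y ^ 2
      = ⟪b 0, u k - x⟫ ^ 2 + ⟪b 1, u k - x⟫ ^ 2 + (⟪u k - x, n⟫ - ℓ) ^ 2 := fun k => by
    rw [dist_eq_norm, ← sub_sub_sub_cancel_right (u k) y x, hdiff, hX0, hY0, hH0, sub_zero,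
      sub_zero]
  have hdd : ∀ i j, dist (u i) (u j) ^ 2 = (⟪b 0, u i - x⟫ - ⟪b 0, u j - x⟫) ^ 2
      + (⟪b 1, u i - x⟫ - ⟪b 1, u j - x⟫) ^ 2 + (⟪u i - x, n⟫ - ⟪u j - x, n⟫) ^ 2 := fun i j => by
    rw [dist_eq_norm, ← sub_sub_sub_cancel_right (u i) (u j) x, hdiff]
  refine no_seven_lens_coords hd hxy hxy' hρ (fun k => ⟪b 0, u k - x⟫) (fun k => ⟪b 1, u k - x⟫)
    (fun k => ⟪u k - x, n⟫) ?_ ?_ ?_ ?_ ?_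
  · intro k; rw [← hdx]; exact pow_le_pow_left₀ hd.le (hu k).1 2
  · intro k; rw [← hdx]; exact pow_le_pow_left₀ dist_nonneg (hu k).2.1 2
  · intro k; rw [← hdy]; exact pow_le_pow_left₀ hd.le (hu k).2.2.1 2
  · intro k; rw [← hdy]; exact pow_le_pow_left₀ dist_nonneg (hu k).2.2.2 2
  · intro i j hij; rw [← hdd]; exact pow_le_pow_left₀ hd.le (hsep i j hij) 2

/-- **Lens capacity six** (stub `stub_lensSix` of line `Sketch`, crux
`SquareWellLayerCake.AveragedTwelve`).  For `0 < d`, `ρ ≤ (57/50) d` and a near pair `x, y`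
(`d ≤ |xy| ≤ ρ`), every finite `d`-separated set of points within `[d, ρ]` of both `x` and `y`
has at most six elements (seven of them would contradict `no_seven_lens_points`). [folklore] -/
theorem stub_lensSix : ∀ (d ρ : ℝ), 0 < d → ρ ≤ 57 / 50 * d → ∀ (x y : EuclideanSpace ℝ (Fin 3)), d ≤ dist x y → dist x y ≤ ρ → ∀ (S : Finset (EuclideanSpace ℝ (Fin 3))), (∀ z ∈ S, d ≤ dist z x ∧ dist z x ≤ ρ ∧ d ≤ dist z y ∧ dist z y ≤ ρ) → (∀ z ∈ S, ∀ w ∈ S, z ≠ w → d ≤ dist z w) → S.card ≤ 6 := by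
  intro d ρ hd hρ x y hxy hxy' S hS hsep
  by_contra h
  obtain ⟨S', hS', hcard⟩ := Finset.exists_subset_card_eq (show 7 ≤ S.card by omega)
  set e := (Finset.equivFinOfCardEq hcard).symm with he
  refine no_seven_lens_points hd hρ hxy hxy' (fun k => ((e k : S') : EuclideanSpace ℝ (Fin 3)))
    (fun k => hS _ (hS' (e k).2)) fun i j hij => hsep _ (hS' (e i).2) _ (hS' (e j).2) ?_
  exact fun h => hij (e.injective (Subtype.val_injective h))

end Summit.AtomisticToContinuum.Crystallization.Theorems.ParFiveRecountLensSix

end
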